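import Literature.NumberTheory.EllipticCurves.CongruenceNumberLevelBound
import Literature.NumberTheory.DiophantineGeometry.MinimalDiscriminantProofs
import Mathlib.NumberTheory.Height.NumberField
import HarnessLib

/-!
# Szpiro's conjecture when the denominator of the `j`-invariant is small (Pasten 2023)

Topic `Literature/NumberTheory/EllipticCurves` (family `abc`, LADDER-ABC A1: the *modular method*,
recent-theorem harvest of the cross-ladder literature-typing layer, seat lit-abc-pasten g2).
Source: H. Pasten, *Szpiro's conjecture when the denominator of the `j`-invariant is small*, Cubo
**28** (2026) no. 2, 383 = arXiv:2308.07114 [`Pasten2023SzpiroSmallDenominator`] (arXiv v2 of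
15 Aug 2023 READ in full, 3 pp.; numbering of the arXiv text). Notation (§1): for `E/ℚ`, `j_E` its
`j`-invariant, `Δ_E` the absolute value of its minimal discriminant, `N_E` its conductor;
`num(q)`, `den(q)` the absolute values of the numerator and denominator of `q ∈ ℚ` in lowest terms,
`h(q) = log max{num(q), den(q)}` the logarithmic height (§2).

The paper proves Szpiro's conjecture for the elliptic curves over `ℚ` whose `j`-invariant has a
denominator of logarithmic size with respect to its numerator, by the MODULAR method: Murty–Pasten's
`h(E) < 0.1 N_E log N_E + 11` (J. Number Theory 133 (2013), Thm 7.1; the tree's named fact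
`MurtyPasten.faltingsHeight_lt`) and Pellarin's comparison `h(j_E) ≤ 24 max{1, h(E)} + 94.3` give
`h(j_E) ≤ 16 N_E log N_E` (Cor 2.1), and Tate's algorithm gives `Δ_E ∣ 16 · den(j_E) · N_E⁵`
(Cor 3.4, from Lemma 3.1 = Pesenti–Szpiro for the primes with `v_p(j_E) ≥ 0`, Lemma 3.2 for the
multiplicative primes, Lemma 3.3 for the additive primes with `v_p(j_E) < 0`, with Lorenzini's bound
on the wild part at `p = 2`).

## Contents

* `Pasten2023_cor_2_1` — NAMED FACT, Cor 2.1: `h(j_E) ≤ 16 · N_E log N_E` for all `E/ℚ`.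
* `Pasten2023_cor_3_4` — NAMED FACT, Cor 3.4: `Δ_E ∣ 16 · den(j_E) · N_E⁵` for all `E/ℚ`.
* `Pasten2023_thm_1_2` — the Main Result, Thm 1.2, as a named statement: for `A, B > 0` and all
  `E/ℚ` with `den(j_E) ≤ A (log num(j_E))^B`, `Δ_E ≤ A · 16^{B+1} · N_E^{B+5} · (log N_E)^B`;
  **PROVED** from the two facts (`Pasten2023_thm_1_2_of_cor`, the printed four-line proof of §4).
* `Pasten2023_thm_1_2.cor_1_3` — Cor 1.3 **PROVED** from Thm 1.2 (`B = 1`): if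
  `den(j_E) ≤ A log num(j_E)` then `Δ_E ≤ 256 A · N_E⁶ log N_E` — Szpiro's conjecture (exponent
  `6 + ε`) on this family, generalising Pesenti–Szpiro (`j_E ∈ ℤ`).

Rendering: `E/ℚ` is `W : WeierstrassCurve ℚ` with `[W.IsElliptic]`; `j_E = W.j` (Mathlib; a model
invariant), `den(j_E) = (W.j).den`, `num(j_E) = (W.j).num.natAbs`, `h(j_E) = Height.logHeight₁ W.j`
(Mathlib's logarithmic height on `ℚ`, `= log max{num, den}` by `Rat.logHeight₁_eq_log_max`);
`Δ_E = W.minimalDiscriminantNorm ℤ`, `N_E = W.conductorNorm ℤ` (both `ℕ`; `N_E ≥ 1` by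
`conductorNorm_pos_holds`, so `log N_E ≥ 0`); real powers `x^B` are `Real.rpow` (bases `≥ 0`).
Faithfulness: Cor 2.1, Cor 3.4, Thm 1.2, Cor 1.3 FAITHFUL (verbatim displays); Lemmas 3.1–3.3 and the
application to `S`-integral points (§1, with Hindry–Silverman) are NOT typed (no carrier needed for
the headline; the local lemmas would want the tree's Kodaira/conductor-exponent currency and are
recorded in the docstring of Cor 3.4). Typed ≠ endorsed; no claim on `abc`.

## References

* [Pasten2023SzpiroSmallDenominator] H. Pasten, Cubo 28 (2026) 383 = arXiv:2308.07114: Thm 1.2,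
  Cor 1.3 (p. 1), Cor 2.1 (§2, p. 2), Lemmas 3.1–3.3 and Cor 3.4 (§3, pp. 2–3), §4 (proof of Thm 1.2).
* [MurtyPasten2013] M. R. Murty, H. Pasten, J. Number Theory 133 (2013), Thm 7.1 (the input
  `h(E) < 0.1 N log N + 11`; tree: `MurtyPasten.faltingsHeight_lt`).
* F. Pellarin, Acta Arith. 100 (2001) 203–243, Lemme 5.2 (`h(j_E)` vs `h(E)`), as cited in §2.
* J. Pesenti, L. Szpiro, Compositio Math. 120 (2000) 83–117 (Lemma 3.1), as cited in §3.
-/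

noncomputable section

open WeierstrassCurve Height

namespace Literature.NumberTheory.EllipticCurves

/-! ### The two inputs (named facts) -/

/-- NAMED FACT — **Pasten 2023, Corollary 2.1.** *"For all elliptic curves `E` over `ℚ` we have
`h(j_E) ≤ 16 · N_E log N_E`."* Here `h(q) = log max{num(q), den(q)}` is the logarithmic height of
`q ∈ ℚ` (Mathlib's `Height.logHeight₁`, `Rat.logHeight₁_eq_log_max`) and `N_E` the conductor.
Printed proof: Murty–Pasten's `h(E) < 0.1 N_E log N_E + 11` (the tree's `MurtyPasten.faltingsHeight_lt`)
and Pellarin's Lemme 5.2 in the form `h(j_E) ≤ 24 max{1, h(E)} + 94.3`, giving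
`h(j_E) ≤ 2.4 N_E log N_E + 358.3`, then `N_E ≥ 11`. A published, proved statement; users take
`(h : Pasten2023_cor_2_1)`. [cite: Pasten2023SzpiroSmallDenominator, Cor. 2.1 (§2)] -/
def Pasten2023_cor_2_1 : Prop :=
  ∀ (W : WeierstrassCurve ℚ) [W.IsElliptic],
    logHeight₁ W.j ≤ 16 * (W.conductorNorm ℤ : ℝ) * Real.log (W.conductorNorm ℤ)

/-- NAMED FACT — **Pasten 2023, Corollary 3.4.** *"Let `E` be an elliptic curve over `ℚ`. Then `Δ_E`
divides `16 · den(j_E) N_E⁵`."* (`Δ_E` the absolute value of the minimal discriminant, `den(j_E)` the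
denominator of the `j`-invariant in lowest terms, `N_E` the conductor.) Printed proof (§3, Tate's
algorithm prime by prime): Lemma 3.1 (Pesenti–Szpiro: `v_p(j_E) ≥ 0 ⟹ v_p(Δ_E) ≤ 5 v_p(N_E)`),
Lemma 3.2 (multiplicative reduction with `v_p(j_E) < 0 ⟹ v_p(Δ_E) = −v_p(j_E)`), Lemma 3.3
(additive reduction with `v_p(j_E) < 0 ⟹ v_p(Δ_E) ≤ 3 v_p(N_E) − v_p(j_E) + δ_p`, `δ₂ = 8`,
`δ_p = 0` for `p ≥ 3`; Ogg's formula and Lorenzini's Thm 2.8 at `p = 2`). Users take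
`(h : Pasten2023_cor_3_4)`. [cite: Pasten2023SzpiroSmallDenominator, Cor. 3.4 (§3)] -/
def Pasten2023_cor_3_4 : Prop :=
  ∀ (W : WeierstrassCurve ℚ) [W.IsElliptic],
    W.minimalDiscriminantNorm ℤ ∣ 16 * (W.j).den * (W.conductorNorm ℤ) ^ 5

/-! ### The Main Result -/

/-- **Pasten 2023, Theorem 1.2 (Main Result)** — the statement. *"Let `A, B > 0`. For all elliptic
curves `E` over `ℚ` with `den(j_E) ≤ A (log num(j_E))^B` we have
`Δ_E ≤ A · 16^{B+1} N_E^{B+5} (log N_E)^B`."* (Real powers; `num(j_E) = |numerator|`, so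
`log num(j_E) ≥ 0`, with `log 0 = 0` when `j_E = 0`.) PROVED below from Cor 2.1 and Cor 3.4
(`Pasten2023_thm_1_2_of_cor`). [cite: Pasten2023SzpiroSmallDenominator, Thm. 1.2] -/
def Pasten2023_thm_1_2 : Prop :=
  ∀ (A B : ℝ), 0 < A → 0 < B → ∀ (W : WeierstrassCurve ℚ) [W.IsElliptic],
    ((W.j).den : ℝ) ≤ A * (Real.log ((W.j).num.natAbs : ℝ)) ^ B →
      (W.minimalDiscriminantNorm ℤ : ℝ) ≤
        A * (16 : ℝ) ^ (B + 1) * (W.conductorNorm ℤ : ℝ) ^ (B + 5) *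
          (Real.log (W.conductorNorm ℤ)) ^ B

/-- `log num(q) ≤ h(q)` for `q ∈ ℚ` (`h(q) = log max{num, den}`; `log 0 = 0 ≤ h`). [folklore] -/
private theorem log_num_le_logHeight₁ (q : ℚ) :
    Real.log (q.num.natAbs : ℝ) ≤ logHeight₁ q := by
  rw [Rat.logHeight₁_eq_log_max]
  rcases Nat.eq_zero_or_pos q.num.natAbs with h0 | hpos
  · rw [h0, Nat.cast_zero, Real.log_zero]
    exact Real.log_nonneg (by exact_mod_cast le_trans q.den_pos (le_max_right _ _))
  · exact Real.log_le_log (by exact_mod_cast hpos) (by exact_mod_cast le_max_left _ _)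

/-- **Pasten 2023, Theorem 1.2, PROVED from Cor 2.1 and Cor 3.4** (the printed proof, §4:
*"By Corollary 2.1 we have `den(j_E) ≤ A(log num(j_E))^B ≤ A h(j_E)^B ≤ A · 16^B N_E^B (log N_E)^B`.
Putting this estimate together with Corollary 3.4 we find `Δ_E ≤ A · 16^{B+1} N_E^{B+5} (log N_E)^B`."*).
[cite: Pasten2023SzpiroSmallDenominator, Thm. 1.2 (proof, §4)] -/
theorem Pasten2023_thm_1_2_of_cor (h21 : Pasten2023_cor_2_1) (h34 : Pasten2023_cor_3_4) :
    Pasten2023_thm_1_2 := by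
  intro A B hA hB W _ hden
  have hNpos : 0 < W.conductorNorm ℤ := conductorNorm_pos_holds W
  set N : ℝ := (W.conductorNorm ℤ : ℝ) with hNdef
  have hN1 : (1 : ℝ) ≤ N := by rw [hNdef]; exact_mod_cast hNpos
  have hN0 : (0 : ℝ) < N := by linarith
  have hlogN : 0 ≤ Real.log N := Real.log_nonneg hN1
  -- Cor 2.1: `log num(j) ≤ h(j) ≤ 16 N log N`, hence `den(j) ≤ A (16 N log N)^B = A 16^B N^B (log N)^B`
  have hlognum0 : 0 ≤ Real.log ((W.j).num.natAbs : ℝ) := by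
    rcases Nat.eq_zero_or_pos (W.j).num.natAbs with h0 | hpos
    · rw [h0, Nat.cast_zero, Real.log_zero]
    · exact Real.log_nonneg (by exact_mod_cast hpos)
  have hh : Real.log ((W.j).num.natAbs : ℝ) ≤ 16 * N * Real.log N :=
    (log_num_le_logHeight₁ W.j).trans (h21 W)
  have hpowle : (Real.log ((W.j).num.natAbs : ℝ)) ^ B ≤ (16 * N * Real.log N) ^ B :=
    Real.rpow_le_rpow hlognum0 hh hB.le
  have hsplit : (16 * N * Real.log N) ^ B = (16 : ℝ) ^ B * N ^ B * (Real.log N) ^ B := by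
    rw [Real.mul_rpow (by positivity) hlogN, Real.mul_rpow (by norm_num) hN0.le]
  have hden' : ((W.j).den : ℝ) ≤ A * ((16 : ℝ) ^ B * N ^ B * (Real.log N) ^ B) := by
    rw [← hsplit]
    exact hden.trans (mul_le_mul_of_nonneg_left hpowle hA.le)
  -- Cor 3.4: `Δ ≤ 16 den(j) N^5`
  have hdvd := h34 W
  have hpos : 0 < 16 * (W.j).den * (W.conductorNorm ℤ) ^ 5 :=
    Nat.mul_pos (Nat.mul_pos (by norm_num) (W.j).den_pos) (pow_pos hNpos 5)
  have hΔle : (W.minimalDiscriminantNorm ℤ : ℝ) ≤ 16 * ((W.j).den : ℝ) * N ^ (5 : ℕ) := by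
    have := Nat.le_of_dvd hpos hdvd
    rw [hNdef]
    exact_mod_cast this
  -- assemble: `16 · (A 16^B N^B (log N)^B) · N^5 = A 16^{B+1} N^{B+5} (log N)^B`
  have h16 : (16 : ℝ) ^ (B + 1) = (16 : ℝ) ^ B * 16 := by
    rw [Real.rpow_add (by norm_num), Real.rpow_one]
  have hN5 : N ^ (B + 5) = N ^ B * N ^ (5 : ℕ) := by
    rw [Real.rpow_add hN0, ← Real.rpow_natCast]
    norm_num
  have hN5pos : (0 : ℝ) ≤ N ^ (5 : ℕ) := by positivity
  calc (W.minimalDiscriminantNorm ℤ : ℝ) ≤ 16 * ((W.j).den : ℝ) * N ^ (5 : ℕ) := hΔle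
    _ ≤ 16 * (A * ((16 : ℝ) ^ B * N ^ B * (Real.log N) ^ B)) * N ^ (5 : ℕ) := by
        gcongr
    _ = A * (16 : ℝ) ^ (B + 1) * N ^ (B + 5) * (Real.log N) ^ B := by
        rw [h16, hN5]; ring

/-- **Pasten 2023, Corollary 1.3 (Szpiro's conjecture when `den(j_E)` is small), PROVED from
Thm 1.2** (`B = 1`): *"Let `A > 0`. For all elliptic curves `E` over `ℚ` with `den(j_E) ≤ A · log num(j_E)`
we have `Δ_E ≤ 256 A · N_E⁶ log N_E`."* — this generalises Pesenti–Szpiro (`j_E ∈ ℤ`).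
[cite: Pasten2023SzpiroSmallDenominator, Cor. 1.3] -/
theorem Pasten2023_thm_1_2.cor_1_3 (h : Pasten2023_thm_1_2) {A : ℝ} (hA : 0 < A)
    (W : WeierstrassCurve ℚ) [W.IsElliptic]
    (hden : ((W.j).den : ℝ) ≤ A * Real.log ((W.j).num.natAbs : ℝ)) :
    (W.minimalDiscriminantNorm ℤ : ℝ) ≤
      256 * A * (W.conductorNorm ℤ : ℝ) ^ (6 : ℕ) * Real.log (W.conductorNorm ℤ) := by
  have hNpos : 0 < W.conductorNorm ℤ := conductorNorm_pos_holds W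
  have hN0 : (0 : ℝ) < (W.conductorNorm ℤ : ℝ) := by exact_mod_cast hNpos
  have h1 := h A 1 hA one_pos W (by rwa [Real.rpow_one])
  rw [Real.rpow_one, show (1 : ℝ) + 1 = (2 : ℕ) by norm_num, show (1 : ℝ) + 5 = (6 : ℕ) by norm_num,
    Real.rpow_natCast, Real.rpow_natCast] at h1
  calc (W.minimalDiscriminantNorm ℤ : ℝ)
      ≤ A * (16 : ℝ) ^ (2 : ℕ) * (W.conductorNorm ℤ : ℝ) ^ (6 : ℕ) * Real.log (W.conductorNorm ℤ) := h1
    _ = 256 * A * (W.conductorNorm ℤ : ℝ) ^ (6 : ℕ) * Real.log (W.conductorNorm ℤ) := by ring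

/-- **Cor 1.3 from the two facts of this file** (Cor 2.1 and Cor 3.4), through Thm 1.2.
[cite: Pasten2023SzpiroSmallDenominator, Cor. 1.3 with Thm. 1.2 (proof, §4)] -/
theorem Pasten2023_cor_1_3_of_cor (h21 : Pasten2023_cor_2_1) (h34 : Pasten2023_cor_3_4) {A : ℝ}
    (hA : 0 < A) (W : WeierstrassCurve ℚ) [W.IsElliptic]
    (hden : ((W.j).den : ℝ) ≤ A * Real.log ((W.j).num.natAbs : ℝ)) :
    (W.minimalDiscriminantNorm ℤ : ℝ) ≤
      256 * A * (W.conductorNorm ℤ : ℝ) ^ (6 : ℕ) * Real.log (W.conductorNorm ℤ) :=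
  (Pasten2023_thm_1_2_of_cor h21 h34).cor_1_3 hA W hden

end Literature.NumberTheory.EllipticCurves

end
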